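import Literature.Topology.FourManifolds.LevelSplicing
import Literature.Topology.FourManifolds.SublevelDiffeoAmbient
import Literature.Topology.FourManifolds.MorseBirthInsertion
import HarnessLib

/-!
# The spliced function is Morse; its critical points

Topic `Literature/Topology/FourManifolds` (fact seat
`provefact-Literature.Topology.FourManifolds.IsHandlebody.exists_diffeomorph_isBoundaryGluing_sphere`,
step F2b₁ of the Lickorish–Wallace DAG; fourth layer of the *level normalisation* feeding L1
`oneHandle_nonempty_diffeomorph` into the level-compatible handle-extension step).  Everything
here is **proved**; no named facts.

For comparison data `c : LevelComparison k M M'` (`Ψ₀ : {f ≤ a} ≅ {f' ≤ a'}`, comparison function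
`G`) the spliced function `F = c.splice L s₀` of `LevelSplicing.lean` equals `f` on
`{a - s₀e^{-L} < f}`, has no critical points on the collar `{a - s ≤ f < a}` (`CollarBound`), and
equals `f' ∘ Ψ₀ + (a - a')` on `{f < a - s₀}`, where `Ψ₀` is read on the ambient manifolds as the
local diffeomorphism `amb Ψ₀` of `SublevelDiffeoAmbient.lean`.  Hence:

* §1 (general) **criticality and the Hessian transport along a local diffeomorphism at interior
  points**: if `F = g ∘ φ + κ` near `x` with `(φ, ψ)` a local inverse pair, then `x` is critical
  for `F` iff `φ x` is critical for `g` (`isMCriticalPt_iff_of_eventuallyEq_comp_add`), and then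
  the Hessians are congruent (`exists_mhessian_eq_of_eventuallyEq_comp_add`: both are read as
  plain second derivatives in `E`-valued charts, `exists_mhessian_apply_eq_fderiv_fderiv_comp_symm`,
  and compared by the second-order chain rule at a critical point,
  `fderiv_fderiv_comp_apply_of_fderiv_eq_zero`; Milnor, *Morse theory* (1963), §2, p. 4), so
  nondegeneracy transfers (`nondegenerate_of_congr`);
* §2 `LevelComparison.isMCriticalPt_splice_iff_of_lt`, `nondegenerate_mhessian_splice_of_lt` on
  `{f < a - s₀}`, and **`LevelComparison.isMorse_splice`**: for Morse `f`, `f'`, a collar bound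
  `B`, `L ≥ B.L₀` and `0 < s₀ ≤ B.s`, the spliced function is a Morse function; its critical
  points are those of `f` in `{a - s₀e^{-L} < f}` and the `Ψ₀`-preimages of those of `f'` in
  `{f < a - s₀}` (`isMCriticalPt_splice_cases`).

## References

* J. Milnor, *Morse theory*, Ann. of Math. Studies 51 (1963), §2. [Milnor1963]
* J. Milnor, *Lectures on the h-cobordism theorem* (1965), Lemma 2.9, proof of Thm. 3.13.
  [MilnorHCobordism1965]
-/

open scoped Manifold ContDiff Topology
open Set Function Filter Metric Real

noncomputable section

namespace Literature.Topology.FourManifolds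

universe u

/-- Local notation: `𝔼 n` is the model Euclidean space `EuclideanSpace ℝ (Fin n)`. -/
local notation "𝔼 " n:arg => EuclideanSpace ℝ (Fin n)
/-- Local notation: `ℍ n` is the model half-space `EuclideanHalfSpace n`. -/
local notation "ℍ " n:arg => EuclideanHalfSpace n

/-! ### §1 Critical points and Hessians along a local diffeomorphism -/

section Transport

variable {E : Type*} [NormedAddCommGroup E] [NormedSpace ℝ E] {H : Type*} [TopologicalSpace H]
  {I : ModelWithCorners ℝ E H}
  {M : Type*} [TopologicalSpace M] [ChartedSpace H M]
  {M' : Type*} [TopologicalSpace M'] [ChartedSpace H M']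

/-- **Nondegeneracy is invariant under congruence**: if `B' (v, w) = B (A v, A w)` for a linear
automorphism `A`, then `B` nondegenerate implies `B'` nondegenerate. [folklore] -/
theorem nondegenerate_of_congr {B B' : LinearMap.BilinForm ℝ E} (A : E ≃L[ℝ] E)
    (h : ∀ v w, B' v w = B (A v) (A w)) (hB : B.Nondegenerate) : B'.Nondegenerate := by
  refine ⟨fun v hv => ?_, fun w hw => ?_⟩
  · have : A v = 0 := hB.1 (A v) fun u => by
      have := hv (A.symm u); rwa [h, A.apply_symm_apply] at this
    simpa using this
  · have : A w = 0 := hB.2 (A w) fun u => by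
      have := hw (A.symm u); rwa [h, A.apply_symm_apply] at this
    simpa using this

/-- **Criticality along a local diffeomorphism.**  If `F = g ∘ φ + κ` near `x` and `(φ, ψ)` is a
local inverse pair at `x` (differentiable, `ψ ∘ φ = id` near `x`, `φ ∘ ψ = id` near `φ x`), then
`x` is a critical point of `F` iff `φ x` is a critical point of `g` (chain rule, `dφ_x` onto).
[cite: Milnor1963, §2] -/
theorem isMCriticalPt_iff_of_eventuallyEq_comp_add {F : M → ℝ} {g : M' → ℝ} {φ : M → M'} {ψ : M' → M}
    {x : M} {κ : ℝ} (hg : MDifferentiableAt I 𝓘(ℝ, ℝ) g (φ x))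
    (hφ : MDifferentiableAt I I φ x) (hψ : MDifferentiableAt I I ψ (φ x))
    (h₁ : ψ ∘ φ =ᶠ[𝓝 x] id) (h₂ : φ ∘ ψ =ᶠ[𝓝 (φ x)] id)
    (hev : F =ᶠ[𝓝 x] fun y => g (φ y) + κ) :
    IsMCriticalPt I F x ↔ IsMCriticalPt I g (φ x) := by
  have hev' : F =ᶠ[𝓝 x] fun y => (g ∘ φ) y + κ := hev
  have hF : mfderiv I 𝓘(ℝ, ℝ) F x = (mfderiv I 𝓘(ℝ, ℝ) g (φ x)).comp (mfderiv I I φ x) := by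
    rw [mfderiv_congr_of_eventuallyEq_add_const hev']
    exact mfderiv_comp x hg hφ
  have hinv : (mfderiv I I φ x).IsInvertible := isInvertible_mfderiv_of_eventuallyEq' hφ hψ h₁ h₂
  obtain ⟨A, hA⟩ := hinv
  unfold IsMCriticalPt
  rw [hF, ← hA]
  constructor
  · intro h
    ext v
    have := ContinuousLinearMap.ext_iff.1 h (A.symm v)
    simp only [ContinuousLinearMap.coe_comp, comp_apply, ContinuousLinearEquiv.coe_coe,
      ContinuousLinearEquiv.apply_symm_apply] at this
    exact this
  · intro h; rw [h, ContinuousLinearMap.zero_comp]; rfl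

variable [IsManifold I ∞ M] [IsManifold I ∞ M']

/-- **Hessians along a local diffeomorphism, at interior critical points.**  If `F = g ∘ φ + κ`
near the interior point `x`, `(φ, ψ)` is a smooth local inverse pair at `x` with `φ x` interior,
and `φ x` is critical for `g` (so `x` is critical for `F`), then the Hessian of `F` at `x` is
congruent to the Hessian of `g` at `φ x`: `Hess F|_x (v, w) = Hess g|_{φ x} (A v, A w)` for a
linear automorphism `A` of `E`.  Both Hessians are read as second derivatives in `E`-valued
charts (`exists_mhessian_apply_eq_fderiv_fderiv_comp_symm`) and compared by the second-order
chain rule at a critical point (`fderiv_fderiv_comp_apply_of_fderiv_eq_zero`); Milnor (1963), §2,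
p. 4 ("the definition does not depend on the coordinate system"). [cite: Milnor1963, §2] -/
theorem exists_mhessian_eq_of_eventuallyEq_comp_add {F : M → ℝ} (hF : ContMDiff I 𝓘(ℝ, ℝ) ∞ F)
    {g : M' → ℝ} (hg : ContMDiff I 𝓘(ℝ, ℝ) ∞ g) {φ : M → M'} {ψ : M' → M} {x : M} {κ : ℝ}
    (hx : I.IsInteriorPoint x) (hx' : I.IsInteriorPoint (φ x))
    (hφ : ContMDiffAt I I ∞ φ x) (hψ : ContMDiffAt I I ∞ ψ (φ x))
    (h₁ : ψ ∘ φ =ᶠ[𝓝 x] id) (h₂ : φ ∘ ψ =ᶠ[𝓝 (φ x)] id)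
    (hev : F =ᶠ[𝓝 x] fun y => g (φ y) + κ) (hcrit : IsMCriticalPt I g (φ x)) :
    ∃ A : E ≃L[ℝ] E, ∀ v w, mhessian I F x v w = mhessian I g (φ x) (A v) (A w) := by
  have hφd : MDifferentiableAt I I φ x := hφ.mdifferentiableAt (by simp)
  have hψd : MDifferentiableAt I I ψ (φ x) := hψ.mdifferentiableAt (by simp)
  have hcritF : IsMCriticalPt I F x :=
    (isMCriticalPt_iff_of_eventuallyEq_comp_add ((hg (φ x)).mdifferentiableAt (by simp)) hφd hψd h₁ h₂ hev).2 hcrit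
  -- the charts
  set Θ₁ : OpenPartialHomeomorph M E := interiorExtChart I x with hΘ₁
  set Θ₂ : OpenPartialHomeomorph M' E := interiorExtChart I (φ x) with hΘ₂
  have hx₁ : x ∈ Θ₁.source := mem_interiorExtChart_source_self hx
  have hx₂ : φ x ∈ Θ₂.source := mem_interiorExtChart_source_self hx'
  set z₁ := Θ₁ x with hz₁
  set z₂ := Θ₂ (φ x) with hz₂
  have hz₁t : z₁ ∈ Θ₁.target := Θ₁.map_source hx₁
  have hz₂t : z₂ ∈ Θ₂.target := Θ₂.map_source hx₂
  have hsymm₁ : Θ₁.symm z₁ = x := by rw [hz₁]; exact Θ₁.left_inv hx₁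
  have hsymm₂ : Θ₂.symm z₂ = φ x := by rw [hz₂]; exact Θ₂.left_inv hx₂
  have hψx : ψ (φ x) = x := by have := h₁.self_of_nhds; simpa using this
  obtain ⟨L₁, hL₁'⟩ := exists_mhessian_apply_eq_fderiv_fderiv_comp_symm (contMDiffOn_interiorExtChart I x)
    (contMDiffOn_interiorExtChart_symm I x) hF hx₁ hx hcritF
  have hL₁ : ∀ v w, mhessian I F x v w = fderiv ℝ (fderiv ℝ (F ∘ Θ₁.symm)) z₁ (L₁ v) (L₁ w) := hL₁'
  obtain ⟨L₂, hL₂'⟩ := exists_mhessian_apply_eq_fderiv_fderiv_comp_symm (contMDiffOn_interiorExtChart I (φ x))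
    (contMDiffOn_interiorExtChart_symm I (φ x)) hg hx₂ hx' hcrit
  have hL₂ : ∀ v w, mhessian I g (φ x) v w = fderiv ℝ (fderiv ℝ (g ∘ Θ₂.symm)) z₂ (L₂ v) (L₂ w) := hL₂'
  -- the coordinate expression of `φ` and of `ψ`
  set τ : E → E := Θ₂ ∘ φ ∘ Θ₁.symm with hτ
  set τ' : E → E := Θ₁ ∘ ψ ∘ Θ₂.symm with hτ'
  have hτz₁ : τ z₁ = z₂ := by simp only [hτ, comp_apply, hsymm₁, hz₂]
  have hΘ₁s : ContMDiffAt 𝓘(ℝ, E) I ∞ Θ₁.symm z₁ :=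
    (contMDiffOn_interiorExtChart_symm I x z₁ hz₁t).contMDiffAt (Θ₁.open_target.mem_nhds hz₁t)
  have hΘ₂s : ContMDiffAt 𝓘(ℝ, E) I ∞ Θ₂.symm z₂ :=
    (contMDiffOn_interiorExtChart_symm I (φ x) z₂ hz₂t).contMDiffAt (Θ₂.open_target.mem_nhds hz₂t)
  have hΘ₁c : ContMDiffAt I 𝓘(ℝ, E) ∞ Θ₁ x :=
    (contMDiffOn_interiorExtChart I x x hx₁).contMDiffAt (Θ₁.open_source.mem_nhds hx₁)
  have hΘ₂c : ContMDiffAt I 𝓘(ℝ, E) ∞ Θ₂ (φ x) :=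
    (contMDiffOn_interiorExtChart I (φ x) (φ x) hx₂).contMDiffAt (Θ₂.open_source.mem_nhds hx₂)
  have hτs : ContDiffAt ℝ ∞ τ z₁ := by
    rw [← contMDiffAt_iff_contDiffAt]
    have h1 : ContMDiffAt 𝓘(ℝ, E) I ∞ (φ ∘ Θ₁.symm) z₁ :=
      ContMDiffAt.comp z₁ (by rw [hsymm₁]; exact hφ) hΘ₁s
    exact ContMDiffAt.comp z₁ (by rw [comp_apply, hsymm₁]; exact hΘ₂c) h1
  have hτ's : ContDiffAt ℝ ∞ τ' z₂ := by
    rw [← contMDiffAt_iff_contDiffAt]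
    have h1 : ContMDiffAt 𝓘(ℝ, E) I ∞ (ψ ∘ Θ₂.symm) z₂ :=
      ContMDiffAt.comp z₂ (by rw [hsymm₂]; exact hψ) hΘ₂s
    exact ContMDiffAt.comp z₂ (by rw [comp_apply, hsymm₂, hψx]; exact hΘ₁c) h1
  -- continuity of the pieces
  have hc₁ : ContinuousAt Θ₁.symm z₁ := Θ₁.continuousAt_symm hz₁t
  have hc₂ : ContinuousAt Θ₂.symm z₂ := Θ₂.continuousAt_symm hz₂t
  have hA₁ : ∀ᶠ z in 𝓝 z₁, z ∈ Θ₁.target := Θ₁.open_target.mem_nhds hz₁t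
  have hA₂ : ∀ᶠ z in 𝓝 z₂, z ∈ Θ₂.target := Θ₂.open_target.mem_nhds hz₂t
  have hC₁ : ∀ᶠ z in 𝓝 z₁, φ (Θ₁.symm z) ∈ Θ₂.source := by
    have hc' : ContinuousAt (φ ∘ Θ₁.symm) z₁ := ContinuousAt.comp (by rw [hsymm₁]; exact hφ.continuousAt) hc₁
    refine hc'.preimage_mem_nhds ?_
    rw [comp_apply, hsymm₁]
    exact Θ₂.open_source.mem_nhds hx₂
  have hC₂ : ∀ᶠ z in 𝓝 z₂, ψ (Θ₂.symm z) ∈ Θ₁.source := by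
    have hc' : ContinuousAt (ψ ∘ Θ₂.symm) z₂ := ContinuousAt.comp (by rw [hsymm₂]; exact hψ.continuousAt) hc₂
    refine hc'.preimage_mem_nhds ?_
    rw [comp_apply, hsymm₂, hψx]
    exact Θ₁.open_source.mem_nhds hx₁
  -- `τ' ∘ τ = id` near `z₁`, `τ ∘ τ' = id` near `z₂`
  have hinv₁ : τ' ∘ τ =ᶠ[𝓝 z₁] id := by
    have hB : ∀ᶠ z in 𝓝 z₁, (ψ ∘ φ) (Θ₁.symm z) = Θ₁.symm z :=
      hc₁.eventually (p := fun y => (ψ ∘ φ) y = y) (by rw [hsymm₁]; exact h₁.mono fun y hy => hy)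
    filter_upwards [hA₁, hB, hC₁] with z hzA hzB hzC
    simp only [hτ, hτ', comp_apply, id_eq]
    rw [Θ₂.left_inv hzC]
    rw [comp_apply] at hzB
    rw [hzB, Θ₁.right_inv hzA]
  have hinv₂ : τ ∘ τ' =ᶠ[𝓝 z₂] id := by
    have hB : ∀ᶠ z in 𝓝 z₂, (φ ∘ ψ) (Θ₂.symm z) = Θ₂.symm z :=
      hc₂.eventually (p := fun y => (φ ∘ ψ) y = y) (by rw [hsymm₂]; exact h₂.mono fun y hy => hy)
    filter_upwards [hA₂, hB, hC₂] with z hzA hzB hzC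
    simp only [hτ, hτ', comp_apply, id_eq]
    rw [Θ₁.left_inv hzC]
    rw [comp_apply] at hzB
    rw [hzB, Θ₂.right_inv hzA]
  -- hence `Dτ(z₁)` is invertible
  have hDτ : (fderiv ℝ τ z₁).IsInvertible := by
    have h := isInvertible_mfderiv_of_eventuallyEq' (I := 𝓘(ℝ, E)) (I' := 𝓘(ℝ, E))
      (hτs.differentiableAt (by simp)).mdifferentiableAt
      (by rw [hτz₁]; exact (hτ's.differentiableAt (by simp)).mdifferentiableAt) hinv₁ (by rw [hτz₁]; exact hinv₂)
    rwa [mfderiv_eq_fderiv] at h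
  obtain ⟨D, hD⟩ := hDτ
  -- `F ∘ Θ₁⁻¹ = (g ∘ Θ₂⁻¹) ∘ τ + κ` near `z₁`
  set P : E → ℝ := (g ∘ Θ₂.symm) ∘ τ with hP
  have hevP : F ∘ Θ₁.symm =ᶠ[𝓝 z₁] fun z => P z + κ := by
    have hB : ∀ᶠ z in 𝓝 z₁, F (Θ₁.symm z) = g (φ (Θ₁.symm z)) + κ :=
      hc₁.eventually (p := fun y => F y = g (φ y) + κ) (by rw [hsymm₁]; exact hev)
    filter_upwards [hB, hC₁] with z hzB hzC
    simp only [hP, hτ, comp_apply, Θ₂.left_inv hzC]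
    exact hzB
  have hD2 : fderiv ℝ (fderiv ℝ (F ∘ Θ₁.symm)) z₁ = fderiv ℝ (fderiv ℝ P) z₁ := by
    have h1 : fderiv ℝ (F ∘ Θ₁.symm) =ᶠ[𝓝 z₁] fderiv ℝ P := by
      filter_upwards [hevP.fderiv (𝕜 := ℝ)] with z hz
      rw [hz]
      exact fderiv_add_const (f := P) (x := z) κ
    exact h1.fderiv_eq
  -- the second-order chain rule at the critical point
  have hgs : ContDiffAt ℝ ∞ (g ∘ Θ₂.symm) z₂ :=
    (contDiffOn_comp_interiorExtChart_symm I hg (φ x)).contDiffAt (Θ₂.open_target.mem_nhds hz₂t)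
  have hcrit₂ : fderiv ℝ (g ∘ Θ₂.symm) z₂ = 0 :=
    (isMCriticalPt_iff_fderiv_comp_symm_eq_zero (contMDiffOn_interiorExtChart I (φ x))
      (contMDiffOn_interiorExtChart_symm I (φ x)) hx₂ ((hg (φ x)).mdifferentiableAt (by simp))).1 hcrit
  have hchain : ∀ v w, fderiv ℝ (fderiv ℝ P) z₁ v w =
      fderiv ℝ (fderiv ℝ (g ∘ Θ₂.symm)) z₂ (fderiv ℝ τ z₁ v) (fderiv ℝ τ z₁ w) := by
    intro v w
    rw [← hτz₁]
    exact fderiv_fderiv_comp_apply_of_fderiv_eq_zero (by rw [hτz₁]; exact hgs.of_le (by norm_cast))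
      (hτs.of_le (by norm_cast)) (by rw [hτz₁]; exact hcrit₂) v w
  -- assemble the congruence
  refine ⟨L₁.trans (D.trans L₂.symm), fun v w => ?_⟩
  rw [hL₁, hD2, hchain, hL₂]
  simp only [ContinuousLinearEquiv.trans_apply, ContinuousLinearEquiv.apply_symm_apply, ← hD,
    ContinuousLinearEquiv.coe_coe]

end Transport

namespace LevelComparison

variable {k : ℕ} {M : Type u} [TopologicalSpace M] [ChartedSpace (ℍ (k + 1)) M] [IsManifold (𝓡∂ (k + 1)) ∞ M]
  {M' : Type u} [TopologicalSpace M'] [ChartedSpace (ℍ (k + 1)) M'] [IsManifold (𝓡∂ (k + 1)) ∞ M']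
  (c : LevelComparison k M M')

/-! ### §2 The splice below the collar: `F = f' ∘ Ψ₀ + (a - a')` -/

/-- The ambient reading of `Ψ₀` (`SublevelDiffeoAmbient.lean`), with a junk value off `{f ≤ a}`.
[folklore] -/
abbrev ambΨ (d : M') : M → M' :=
  amb (csW := c.atlas.chartedSpace) (csW' := c.atlas'.chartedSpace) c.Ψ₀ d

/-- The ambient reading of `Ψ₀⁻¹`. [folklore] -/
abbrev ambΨinv (d₀ : M) : M' → M :=
  ambInv (csW := c.atlas.chartedSpace) (csW' := c.atlas'.chartedSpace) c.Ψ₀ d₀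

/-- On `{f ≤ a}` the ambient map is `Ψ₀`. [folklore] -/
theorem ambΨ_apply (d : M') {x : M} (hx : c.f x ≤ c.a) : c.ambΨ d x = (c.Ψ₀ ⟨x, hx⟩ : M') :=
  sublevelAmbient_apply (Ψ₀ := c.Ψ₀) (d := d) hx

/-- On `{f ≤ a}`, `G = f' ∘ ambΨ`. [folklore] -/
theorem G_eq_f'_ambΨ (d : M') {x : M} (hx : c.f x ≤ c.a) : c.G x = c.f' (c.ambΨ d x) := by
  rw [c.ambΨ_apply d hx, c.G_coe ⟨x, hx⟩]

/-- **Below the collar the splice is `f' ∘ Ψ₀ + (a - a')` near every point.** [folklore] -/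
theorem splice_eventuallyEq_of_lt {L s₀ : ℝ} (hL : 0 < L) (hs₀ : 0 < s₀) (d : M') {x : M}
    (hx : c.f x < c.a - s₀) :
    c.splice L s₀ =ᶠ[𝓝 x] fun y => c.f' (c.ambΨ d y) + (c.a - c.a') := by
  filter_upwards [(isOpen_lt c.hf.continuous continuous_const).mem_nhds hx] with y hy
  rw [c.splice_eq_G hL hs₀ hy.le, c.G_eq_f'_ambΨ d (by linarith)]

variable (hk : 1 ≤ k)
include hk

/-- `ambΨ` is smooth at points of `{f < a}`. [cite: LeeSmoothManifolds2013, Cor. 5.30] -/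
theorem contMDiffAt_ambΨ (d : M') {x : M} (hx : c.f x < c.a) :
    ContMDiffAt (𝓡∂ (k + 1)) (𝓡∂ (k + 1)) ∞ (c.ambΨ d) x :=
  contMDiffAt_amb (hf := c.hf) (hint := c.hint) (hreg := c.hreg) (hf' := c.hf') (hint' := c.hint')
    (hreg' := c.hreg') (csW := c.atlas.chartedSpace) (csW' := c.atlas'.chartedSpace) (Ψ₀ := c.Ψ₀) (d := d)
    hk rfl rfl hx

/-- `ambΨinv` is smooth at points of `{f' < a'}`. [cite: LeeSmoothManifolds2013, Cor. 5.30] -/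
theorem contMDiffAt_ambΨinv (d₀ : M) {z : M'} (hz : c.f' z < c.a') :
    ContMDiffAt (𝓡∂ (k + 1)) (𝓡∂ (k + 1)) ∞ (c.ambΨinv d₀) z :=
  contMDiffAt_ambInv (hf := c.hf) (hint := c.hint) (hreg := c.hreg) (hf' := c.hf') (hint' := c.hint')
    (hreg' := c.hreg') (csW := c.atlas.chartedSpace) (csW' := c.atlas'.chartedSpace) (Ψ₀ := c.Ψ₀) (d₀ := d₀)
    hk rfl rfl hz

omit hk in
/-- `ambΨinv ∘ ambΨ = id` near points of `{f < a}`. [folklore] -/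
theorem ambΨinv_comp_ambΨ (d : M') (d₀ : M) {x : M} (hx : c.f x < c.a) :
    c.ambΨinv d₀ ∘ c.ambΨ d =ᶠ[𝓝 x] id :=
  ambInv_comp_amb_eventuallyEq (csW := c.atlas.chartedSpace) (csW' := c.atlas'.chartedSpace) (Ψ₀ := c.Ψ₀)
    c.hf.continuous hx

omit hk in
/-- `ambΨ ∘ ambΨinv = id` near points of `{f' < a'}`. [folklore] -/
theorem ambΨ_comp_ambΨinv (d : M') (d₀ : M) {z : M'} (hz : c.f' z < c.a') :
    c.ambΨ d ∘ c.ambΨinv d₀ =ᶠ[𝓝 z] id :=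
  amb_comp_ambInv_eventuallyEq (csW := c.atlas.chartedSpace) (csW' := c.atlas'.chartedSpace) (Ψ₀ := c.Ψ₀)
    c.hf'.continuous hz

/-- Critical points of the splice below the collar, ambient form: `x` is critical for the splice
iff `ambΨ d x` is critical for `f'`. [cite: Milnor1963, §2] -/
theorem isMCriticalPt_splice_iff_ambΨ {L s₀ : ℝ} (hL : 0 < L) (hs₀ : 0 < s₀) (d : M') {x : M}
    (hx : c.f x < c.a - s₀) :
    IsMCriticalPt (𝓡∂ (k + 1)) (c.splice L s₀) x ↔ IsMCriticalPt (𝓡∂ (k + 1)) c.f' (c.ambΨ d x) := by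
  have hxa : c.f x < c.a := by linarith
  have hx' : c.f' (c.ambΨ d x) < c.a' := by rw [← c.G_eq_f'_ambΨ d hxa.le]; exact c.G_lt_of_lt x hxa
  exact isMCriticalPt_iff_of_eventuallyEq_comp_add ((c.hf' _).mdifferentiableAt (by simp))
    ((c.contMDiffAt_ambΨ hk d hxa).mdifferentiableAt (by simp))
    ((c.contMDiffAt_ambΨinv hk x hx').mdifferentiableAt (by simp))
    (c.ambΨinv_comp_ambΨ d x hxa) (c.ambΨ_comp_ambΨinv d x hx') (c.splice_eventuallyEq_of_lt hL hs₀ d hx)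

/-- **Critical points of the splice below the collar** are the `Ψ₀`-preimages of the critical
points of `f'`. [cite: Milnor1963, §2] -/
theorem isMCriticalPt_splice_iff_of_lt {L s₀ : ℝ} (hL : 0 < L) (hs₀ : 0 < s₀) {x : M}
    (hx : c.f x < c.a - s₀) :
    IsMCriticalPt (𝓡∂ (k + 1)) (c.splice L s₀) x ↔
      IsMCriticalPt (𝓡∂ (k + 1)) c.f' (c.Ψ₀ ⟨x, (by linarith : c.f x ≤ c.a)⟩ : M') := by
  have hxa : c.f x < c.a := by linarith
  have h := c.isMCriticalPt_splice_iff_ambΨ hk hL hs₀ (c.Ψ₀ ⟨x, hxa.le⟩ : M') hx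
  rwa [c.ambΨ_apply _ hxa.le] at h

/-- Nondegeneracy of the splice below the collar, ambient form. [cite: Milnor1963, §2] -/
theorem nondegenerate_mhessian_splice_ambΨ {L s₀ : ℝ} (hL : 0 < L) (hs₀ : 0 < s₀) (d : M') {x : M}
    (hx : c.f x < c.a - s₀) (hcrit : IsMCriticalPt (𝓡∂ (k + 1)) c.f' (c.ambΨ d x))
    (hnd : (mhessian (𝓡∂ (k + 1)) c.f' (c.ambΨ d x)).Nondegenerate) :
    (mhessian (𝓡∂ (k + 1)) (c.splice L s₀) x).Nondegenerate := by
  have hxa : c.f x < c.a := by linarith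
  have hx' : c.f' (c.ambΨ d x) < c.a' := by rw [← c.G_eq_f'_ambΨ d hxa.le]; exact c.G_lt_of_lt x hxa
  have hint₁ : (𝓡∂ (k + 1)).IsInteriorPoint x := c.hint x hxa.le
  have hint₂ : (𝓡∂ (k + 1)).IsInteriorPoint (c.ambΨ d x) := c.hint' _ hx'.le
  obtain ⟨A, hA⟩ := exists_mhessian_eq_of_eventuallyEq_comp_add (c.contMDiff_splice hL hs₀) c.hf' hint₁ hint₂
    (c.contMDiffAt_ambΨ hk d hxa) (c.contMDiffAt_ambΨinv hk x hx') (c.ambΨinv_comp_ambΨ d x hxa)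
    (c.ambΨ_comp_ambΨinv d x hx') (c.splice_eventuallyEq_of_lt hL hs₀ d hx) hcrit
  exact nondegenerate_of_congr A hA hnd

/-- **Nondegeneracy of the splice below the collar**: at a point `x` with `f x < a - s₀` such
that `Ψ₀ x` is a nondegenerate critical point of `f'`, the Hessian of the splice at `x` is
nondegenerate. [cite: Milnor1963, §2] -/
theorem nondegenerate_mhessian_splice_of_lt {L s₀ : ℝ} (hL : 0 < L) (hs₀ : 0 < s₀) {x : M}
    (hx : c.f x < c.a - s₀)
    (hcrit : IsMCriticalPt (𝓡∂ (k + 1)) c.f' (c.Ψ₀ ⟨x, (by linarith : c.f x ≤ c.a)⟩ : M'))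
    (hnd : (mhessian (𝓡∂ (k + 1)) c.f' (c.Ψ₀ ⟨x, (by linarith : c.f x ≤ c.a)⟩ : M')).Nondegenerate) :
    (mhessian (𝓡∂ (k + 1)) (c.splice L s₀) x).Nondegenerate := by
  have hxa : c.f x < c.a := by linarith
  refine c.nondegenerate_mhessian_splice_ambΨ hk hL hs₀ (c.Ψ₀ ⟨x, hxa.le⟩ : M') hx ?_ ?_
  · rw [c.ambΨ_apply _ hxa.le]; exact hcrit
  · rw [c.ambΨ_apply _ hxa.le]; exact hnd

omit hk in
/-- **Above the collar the splice is `f` near every point** of `{a - s₀e^{-L} < f}`. [folklore] -/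
theorem splice_eventuallyEq_of_gt {L s₀ : ℝ} {x : M} (hx : c.a - s₀ * exp (-L) < c.f x) :
    c.splice L s₀ =ᶠ[𝓝 x] fun y => c.f y + 0 := by
  filter_upwards [(isOpen_lt continuous_const c.hf.continuous).mem_nhds hx] with y hy
  rw [add_zero, c.splice_eq_f hy.le]

omit hk in
/-- Critical points of the splice above the collar are those of `f`. [folklore] -/
theorem isMCriticalPt_splice_iff_of_gt {L s₀ : ℝ} {x : M} (hx : c.a - s₀ * exp (-L) < c.f x) :
    IsMCriticalPt (𝓡∂ (k + 1)) (c.splice L s₀) x ↔ IsMCriticalPt (𝓡∂ (k + 1)) c.f x :=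
  isMCriticalPt_congr_of_eventuallyEq_add_const (c.splice_eventuallyEq_of_gt hx)

/-- **The critical points of the splice** (for `L ≥ L₀`, `0 < s₀ ≤ s`): either above the
collar (`a - s₀e^{-L} < f x`, a critical point of `f`) or below it (`f x < a - s₀`, with `Ψ₀ x`
a critical point of `f'`); nothing on the collar. [cite: MilnorHCobordism1965, proof of Thm. 3.13] -/
theorem isMCriticalPt_splice_cases (B : c.CollarBound) {L s₀ : ℝ} (hL : B.L₀ ≤ L) (hs₀ : 0 < s₀)
    (hs : s₀ ≤ B.s) {x : M} (hx : IsMCriticalPt (𝓡∂ (k + 1)) (c.splice L s₀) x) :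
    (c.a - s₀ * exp (-L) < c.f x ∧ IsMCriticalPt (𝓡∂ (k + 1)) c.f x) ∨
      (∃ h : c.f x < c.a - s₀, IsMCriticalPt (𝓡∂ (k + 1)) c.f' (c.Ψ₀ ⟨x, (by linarith : c.f x ≤ c.a)⟩ : M')) := by
  have hL0 : 0 < L := B.L₀_pos.trans_le hL
  by_cases h1 : c.a - s₀ * exp (-L) < c.f x
  · exact Or.inl ⟨h1, (c.isMCriticalPt_splice_iff_of_gt h1).1 hx⟩
  · have hfa : c.f x < c.a := by
      have : 0 < s₀ * exp (-L) := mul_pos hs₀ (exp_pos _)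
      linarith [not_lt.1 h1]
    by_cases h2 : c.a - B.s ≤ c.f x
    · exact absurd hx (B.not_isMCriticalPt_splice hL hs₀ h2 hfa)
    · have h3 : c.f x < c.a - s₀ := by linarith [not_le.1 h2]
      exact Or.inr ⟨h3, (c.isMCriticalPt_splice_iff_of_lt hk hL0 hs₀ h3).1 hx⟩

/-- **The spliced function is a Morse function** when `f` and `f'` are, for `L ≥ L₀` and
`0 < s₀ ≤ s`. [cite: MilnorHCobordism1965, Lemma 2.9 and proof of Thm. 3.13] -/
theorem isMorse_splice (hfM : IsMorse (𝓡∂ (k + 1)) c.f) (hfM' : IsMorse (𝓡∂ (k + 1)) c.f')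
    (B : c.CollarBound) {L s₀ : ℝ} (hL : B.L₀ ≤ L) (hs₀ : 0 < s₀) (hs : s₀ ≤ B.s) :
    IsMorse (𝓡∂ (k + 1)) (c.splice L s₀) := by
  have hL0 : 0 < L := B.L₀_pos.trans_le hL
  refine ⟨c.contMDiff_splice hL0 hs₀, fun x hx => ?_⟩
  rcases c.isMCriticalPt_splice_cases hk B hL hs₀ hs hx with ⟨h1, hc⟩ | ⟨h1, hc⟩
  · rw [mhessian_congr_of_eventuallyEq_add_const (c.splice_eventuallyEq_of_gt h1)]
    exact hfM.nondegenerate hc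
  · exact c.nondegenerate_mhessian_splice_of_lt hk hL0 hs₀ h1 hc (hfM'.nondegenerate hc)

end LevelComparison

end Literature.Topology.FourManifolds

end
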